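import Summits.QuantumFields.YangMills.Theorems.BalabanUVNodesN08RelativeTo5

/-!
# BalabanUVNodes ∕ N08 «RELATIVE TO THE PRINTED (5)», SHARPEST DATA FORM — Thm 1's bounds (5) (compact reading) from PER-RUN representation data
# with a RUN-UNIFORM bound on the DISPLAYED O(1) `B10Assembly.O1 = aI + bW + cR + d`; the slot of record, the primed slot and N08 at the ₉CB10 ∕ ₁₁CB10YZW
# records in that currency (Track A, DAG node N08 = [Balaban1985UV3] CMP 102 (1985) 255, Thm 1 p. 257 + Thm 2 p. 272 + Sect. D pp. 272–274; cell `pub-ymgap`,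
# R141 (C) fan-out seat `pub-ymgap-dag-n08-e`, FAN-OUT v1.1 §N08 row s3; sequel of `BalabanUVNodesN08RelativeTo5` (p454359 ∕ v1.1 p455323); `--supports` K1)

WHAT PRINT SAYS.  p. 257 L1: «and the constant O(1) is independent of ε, k, g_k in a bounded set.»; Sect. D p. 272: «We have to show that the inequalities
(41), (47) imply Theorem 1, i.e. the inequalities (5). … We estimate the interaction terms using the bounds (44)–(46) by O(1)M₁³g²_{k−1}p²(g_{k−1})|Λ_k| ≤
O(1)|T₁^{(k)}|.», (65)–(66) p. 273 and the large-field control pp. 273–274.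

WHAT THIS FILE ADDS to the currency of `BalabanUVNodesN08RelativeTo5` (slot = «(5), compact reading» ∧ «per-run data»; per-run data ⇏ (5), companion witness
`BalabanUVNodesN08LargeFieldConstFamily`).  The cell's Sect. D gives (5) at every run FROM ITS OWN leaf system with the DISPLAYED constant
`B10Assembly.O1 C gmin gmax = aI C + bW C gmin gmax + cR C + C.d` (`B10Assembly.bounds5_of_leafSystem`: interaction (46) + Sect. D line 1, counterterm
(62)∕(64)∕(65) with the `d(𝔤) log g_k` window term, remainder (41), large fields pp. 273–274), and (5) is monotone in its constant (`bounds5At_mono`, here).  Hence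
(§1) per-run data whose displayed O(1) is bounded by ONE function `O gmin gmax` for all lattice approximations give `B10.Thm1PrintedCompact` — print's uniformity
clause as a condition on FOUR displayed numbers per run, not on the whole leaf system (`thm1Compact_runsAtG_of_perRunUniformO1`) —, hence the slot at `c`, the
printed pair, the slot of record `Node00.PrintedUV3V`, the primed slot `Node00.PrintedUV3V'` and N08 at the records of record (§1, all BY NAME).  UNIFORM leaf
systems (n08-a's supplier face) are the special case `O := O1 C` (`perRunUniformO1_of_uniformLeafSystemsG`); the companion's `bounds5At_lfRun_iff` shows the
bound is load-bearing already in its `d`-component.  So, in data currency, N08's residual beyond run-by-run towers is EXACTLY «sup over runs of the displayed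
O(1) is finite on every compact coupling window».

HONEST FRAMING: count-neutral kernel bookkeeping BY NAME (THEOREMS ONLY, 0 def); N08 NOT discharged; neither the per-run data nor the bound are asserted; one finite
T⁴ programme at fixed ε with the d = 3 lattices of [B10] inside the record; nothing continuum ∕ ℝ⁴ ∕ OS ∕ mass gap ∕ Clay.
-/

noncomputable section

namespace Summit.QuantumFields.YangMills.Theorems.BalabanUVNodesN08UniformO1

open Literature.MathematicalPhysics.QuantumFieldTheory.Balaban1983to89
open Literature.MathematicalPhysics.QuantumFieldTheory.Balaban1983to89.T4Continuum (T4Family FiniteEpsData)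
open Literature.MathematicalPhysics.QuantumFieldTheory.Balaban1983to89.DagBinding (WorldP leavesP)
open Literature.MathematicalPhysics.QuantumFieldTheory.Balaban1983to89.Node00
open Literature.MathematicalPhysics.QuantumFieldTheory.Balaban1983to89.B10RunsOfRecord
  (Consts Repr41_47G withReprSlot runsAtG b10AtG PrintedUV3G UniformLeafSystemsG runObjects₀T Backgrounds)
open Literature.MathematicalPhysics.QuantumFieldTheory.Balaban1985CMP102
open Literature.MathematicalPhysics.QuantumFieldTheory.Balaban1985CMP102.Setting
open Literature.MathematicalPhysics.QuantumFieldTheory.Balaban1985CMP102.Theorems (Family)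
open Summit.QuantumFields.YangMills.BalabanUVNodes.N08AtRecord9CB10 (s_N08_of_refines₉CB10)
open Summit.QuantumFields.YangMills.Theorems.BalabanUVNodesN08RelativeTo5 (b10AtG_iff_thm1Compact_and_perRun)
open YMDAG.UVSplit (RecordPred Datum S_N08)

/-! ## §1 THE RESIDUAL IN DATA CURRENCY, SHARPEST FORM — (5) in the compact reading ⟸ per-run data WITH A RUN-UNIFORM BOUND ON THE DISPLAYED O(1)

Sect. D gives (5) at every run from ITS OWN leaf system with the
DISPLAYED constant `B10Assembly.O1 C gmin gmax = aI C + bW C gmin gmax + cR C + C.d` (`B10Assembly.bounds5_of_leafSystem`); (5) is monotone in its constant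
(`bounds5At_mono`); so per-run data whose displayed O(1) is bounded by ONE function `O gmin gmax` for all runs give Thm 1 in the compact reading — print's
«O(1) independent of ε, k» (p. 257 L1) as a condition on FOUR displayed numbers per run (interaction `aI`, counterterm `bW`, remainder `cR`, large fields `d`),
not on the whole leaf system.  Uniform leaf systems are the special case `O := O1 C` (`perRunUniformO1_of_uniformLeafSystemsG`).  The companion module
`BalabanUVNodesN08LargeFieldConstFamily` shows the condition is load-bearing already in its `d`-component (`bounds5At_lfRun_iff`).  Count-neutral; NOT a discharge. -/

section UniformO1

open Literature.MathematicalPhysics.QuantumFieldTheory.Balaban1983to89.B10RunsOfRecord (bounds5At_pin_iff_of_eqG runObjects₀A)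

/-- **(5) is monotone in its constant** over any tower run: a larger O(1) still serves at step `k` (`χ_k ≥ 0`, `|T₁^{(k)}| ≥ 0`, `exp` monotone).
Re-derived bookkeeping. [cite: Balaban1985UV3, (5) p.256] -/
theorem bounds5At_mono (T : B10.TowerRun) {O1 O1' : ℝ} (hle : O1 ≤ O1') (k : ℕ) (h : B10.Bounds5At T.toRunData O1 k) :
    B10.Bounds5At T.toRunData O1' k := by
  intro U
  obtain ⟨hlo, hhi⟩ := h U
  have hmul : O1 * T.sites k ≤ O1' * T.sites k := mul_le_mul_of_nonneg_right hle (T.sites_nonneg k)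
  refine ⟨le_trans ?_ hlo, hhi.trans (Real.exp_le_exp.mpr hmul)⟩
  exact mul_le_mul_of_nonneg_left (Real.exp_le_exp.mpr (by linarith)) (T.χ_nonneg k U)

variable (N : ℕ) [NeZero N] {L : ℕ} (R₀ : Consts L → ∀ S : Scales L, RunObjects S (SU N)) (c : Consts L)

/-- **THEOREM 1 (COMPACT READING) FROM PER-RUN DATA WITH A RUN-UNIFORM BOUND ON THE DISPLAYED O(1)**: if every lattice approximation `S` of the family
carries tower objects over its binders with a leaf system for constants `C_S` AND `B10Assembly.O1 C_S gmin gmax ≤ O gmin gmax` for one function `O` and all `S`,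
then `B10.Thm1PrintedCompact (runsAtG N R₀ c)` with `O(1) := O gmin gmax` (per run: `B10Assembly.bounds5_of_leafSystem` on the one-member family,
transported by `B10RunsOfRecord.bounds5At_pin_iff_of_eqG`, enlarged by `bounds5At_mono`).  This is the sharpest sufficient form of «O(1) independent of ε, k»
the tree's Sect. D supports. [cite: Balaban1985UV3, Thm 1 p.257, (5) p.256, Sect. D pp.272–274] -/
theorem thm1Compact_runsAtG_of_perRunUniformO1 (O : ℝ → ℝ → ℝ)
    (h : ∀ S : Family L c.eps0, ∃ (C : B10Assembly.Consts) (W : SectB.TowerObjects S.1 (SU N)),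
      W.toRunObjects = R₀ c S.1 ∧ Nonempty (B10Assembly.LeafSystem C W.pin.toTowerRun) ∧
        ∀ gmin gmax : ℝ, 0 < gmin → gmin ≤ gmax → B10Assembly.O1 C gmin gmax ≤ O gmin gmax) :
    B10.Thm1PrintedCompact (runsAtG N R₀ c) := by
  intro gmin gmax hmin hle
  refine ⟨O gmin gmax, fun S k hk h1 h2 => ?_⟩
  obtain ⟨C, W, hW, ⟨LS⟩, hO⟩ := h S
  have h5 : B10.Bounds5At W.pin.toTowerRun.toRunData (B10Assembly.O1 C gmin gmax) k :=
    B10Assembly.bounds5_of_leafSystem (fun _ : Unit => W.pin.toTowerRun) (fun _ => LS) hmin () k hk h1 h2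
  exact (bounds5At_pin_iff_of_eqG N R₀ c W hW (O gmin gmax) k).1
    (bounds5At_mono W.pin.toTowerRun (hO gmin gmax hmin hle) k h5)

/-- … hence the whole slot at `c`: `b10AtG N R₀ c` from per-run data with a run-uniform bound on the displayed O(1) (Thm 2 half by §1).
[cite: Balaban1985UV3, Thm 1 p.257 (compact reading) + Thm 2 p.272] -/
theorem b10AtG_of_perRunUniformO1 (O : ℝ → ℝ → ℝ)
    (h : ∀ S : Family L c.eps0, ∃ (C : B10Assembly.Consts) (W : SectB.TowerObjects S.1 (SU N)),
      W.toRunObjects = R₀ c S.1 ∧ Nonempty (B10Assembly.LeafSystem C W.pin.toTowerRun) ∧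
        ∀ gmin gmax : ℝ, 0 < gmin → gmin ≤ gmax → B10Assembly.O1 C gmin gmax ≤ O gmin gmax) :
    b10AtG N R₀ c :=
  (b10AtG_iff_thm1Compact_and_perRun N R₀ c).2
    ⟨thm1Compact_runsAtG_of_perRunUniformO1 N R₀ c O h, fun S => by
      obtain ⟨C, W, hW, hLS, -⟩ := h S
      exact ⟨C, W, hW, hLS⟩⟩

variable (L) in
/-- … and the printed pair with its ∃-prefix, at admissible `c`. [cite: Balaban1985UV3, Thm 1 p.257 (compact reading) + Thm 2 p.272, p.256 L15–18] -/
theorem printedUV3G_of_perRunUniformO1 (hc : c.Adm) (O : ℝ → ℝ → ℝ)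
    (h : ∀ S : Family L c.eps0, ∃ (C : B10Assembly.Consts) (W : SectB.TowerObjects S.1 (SU N)),
      W.toRunObjects = R₀ c S.1 ∧ Nonempty (B10Assembly.LeafSystem C W.pin.toTowerRun) ∧
        ∀ gmin gmax : ℝ, 0 < gmin → gmin ≤ gmax → B10Assembly.O1 C gmin gmax ≤ O gmin gmax) :
    PrintedUV3G N L R₀ :=
  ⟨c, hc, b10AtG_of_perRunUniformO1 N R₀ c O h⟩

/-- UNIFORM leaf systems are the special case `O := B10Assembly.O1 C` of the run-uniform O(1) bound (so n08-a's supplier face is an instance of this one).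
[cite: Balaban1985UV3, Thm 1 p.257 L1] -/
theorem perRunUniformO1_of_uniformLeafSystemsG (h : UniformLeafSystemsG N R₀ c) :
    ∃ O : ℝ → ℝ → ℝ, ∀ S : Family L c.eps0, ∃ (C : B10Assembly.Consts) (W : SectB.TowerObjects S.1 (SU N)),
      W.toRunObjects = R₀ c S.1 ∧ Nonempty (B10Assembly.LeafSystem C W.pin.toTowerRun) ∧
        ∀ gmin gmax : ℝ, 0 < gmin → gmin ≤ gmax → B10Assembly.O1 C gmin gmax ≤ O gmin gmax := by
  obtain ⟨C, hS⟩ := h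
  refine ⟨B10Assembly.O1 C, fun S => ?_⟩
  obtain ⟨W, hW, hLS⟩ := hS S
  exact ⟨C, W, hW, hLS, fun _ _ _ _ => le_rfl⟩

variable (L) in
/-- **SUPPLIER FACE OF THE SLOT OF RECORD IN THE SHARPEST DATA CURRENCY**: a version `𝔗` of print's transformations, admissible constants `c`, and per-run
representation data over `runObjects₀T N 𝔗 (Backgrounds.ofPrint N L)` whose displayed O(1) is bounded run-uniformly give `Node00.PrintedUV3V N L`.
What a lane END theorem must add to its run-by-run towers for N08 is exactly the bound `hO` inside `h`. [cite: Balaban1985UV3, Thm 1 p.257, Thm 2 p.272, Sect. D pp.272–274] -/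
theorem printedUV3V_of_perRunUniformO1 (𝔗 : TFamily₃ N L) (c : Consts L) (hc : c.Adm) (O : ℝ → ℝ → ℝ)
    (h : ∀ S : Family L c.eps0, ∃ (C : B10Assembly.Consts) (W : SectB.TowerObjects S.1 (SU N)),
      W.toRunObjects = runObjects₀T N 𝔗 (Backgrounds.ofPrint N L) c S.1 ∧ Nonempty (B10Assembly.LeafSystem C W.pin.toTowerRun) ∧
        ∀ gmin gmax : ℝ, 0 < gmin → gmin ≤ gmax → B10Assembly.O1 C gmin gmax ≤ O gmin gmax) :
    PrintedUV3V N L :=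
  ⟨𝔗, printedUV3G_of_perRunUniformO1 N L _ c hc O h⟩

variable (L) in
/-- … and of the PRIMED slot, along any admissible averaging family. [cite: Balaban1985UV3, Thm 1 p.257, Thm 2 p.272; Balaban1987RG1, (0.4)–(0.9) p.253] -/
theorem printedUV3V'_of_perRunUniformO1 {𝔞 : AvgFamily₃ N L} (h𝔞 : AvgAdmissible₃ N 𝔞) (𝔗 : TFamilyA₃ N 𝔞) (c : Consts L) (hc : c.Adm)
    (O : ℝ → ℝ → ℝ)
    (h : ∀ S : Family L c.eps0, ∃ (C : B10Assembly.Consts) (W : SectB.TowerObjects S.1 (SU N)),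
      W.toRunObjects = runObjects₀A N 𝔞 𝔗 (Backgrounds.ofAvg N L 𝔞) c S.1 ∧ Nonempty (B10Assembly.LeafSystem C W.pin.toTowerRun) ∧
        ∀ gmin gmax : ℝ, 0 < gmin → gmin ≤ gmax → B10Assembly.O1 C gmin gmax ≤ O gmin gmax) :
    PrintedUV3V' N L :=
  ⟨𝔞, h𝔞, 𝔗, printedUV3G_of_perRunUniformO1 N L _ c hc O h⟩

variable {N} {F : T4Family} {D : Datum F N} {w : WorldP}

/-- **N08 · [Balaban1985UV3] AT EVERY ₁₁CB10YZW RECORD FROM PER-RUN DATA WITH A RUN-UNIFORM O(1) BOUND** (the K1-facing form in the sharpest data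
currency; g31's `Node00.b10_main_iff_of_isRecordOfRecord₁₁CB10YZW` BY NAME; in-edges unused).  NOT-A-DISCHARGE: the hypothesis is N08's object gap in data form.
[cite: Balaban1985UV3, Thm 1 p.257, Thm 2 p.272, Sect. D pp.272–274] -/
theorem b10_main_of_isRecordOfRecord₁₁CB10YZW_of_perRunUniformO1
    (h : ∀ L : ℕ, Odd L → 1 < L → ∃ (𝔗 : TFamily₃ N L) (c : Consts L), c.Adm ∧ ∃ O : ℝ → ℝ → ℝ,
      ∀ S : Family L c.eps0, ∃ (C : B10Assembly.Consts) (W : SectB.TowerObjects S.1 (SU N)),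
        W.toRunObjects = runObjects₀T N 𝔗 (Backgrounds.ofPrint N L) c S.1 ∧ Nonempty (B10Assembly.LeafSystem C W.pin.toTowerRun) ∧
          ∀ gmin gmax : ℝ, 0 < gmin → gmin ≤ gmax → B10Assembly.O1 C gmin gmax ≤ O gmin gmax)
    (hR : IsRecordOfRecord₁₁CB10YZW F N D w) (P : B12.RunParams) : Dag.B10_main (leavesP w P) := by
  obtain ⟨L, hL, -, hiff⟩ := b10_main_iff_of_isRecordOfRecord₁₁CB10YZW hR
  obtain ⟨𝔗, c, hc, O, hdata⟩ := h L hL.1 hL.2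
  exact (hiff P).2 fun _ _ _ _ _ _ => printedUV3V_of_perRunUniformO1 N L 𝔗 c hc O hdata

/-- … and `S_N08 Rec` for every record predicate refining ₉CB10 (n08-a's `s_N08_of_refines₉CB10` BY NAME). [cite: Balaban1985UV3, Thm 1 p.257, Thm 2 p.272, Sect. D pp.272–274] -/
theorem s_N08_of_refines₉CB10_of_perRunUniformO1 (Rec : RecordPred N)
    (href : ∀ (F : T4Family) (D : Datum F N) (w : WorldP), Rec F D w → IsRecordOfRecord₉CB10 F N D w)
    (h : ∀ L : ℕ, Odd L → 1 < L → ∃ (𝔗 : TFamily₃ N L) (c : Consts L), c.Adm ∧ ∃ O : ℝ → ℝ → ℝ,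
      ∀ S : Family L c.eps0, ∃ (C : B10Assembly.Consts) (W : SectB.TowerObjects S.1 (SU N)),
        W.toRunObjects = runObjects₀T N 𝔗 (Backgrounds.ofPrint N L) c S.1 ∧ Nonempty (B10Assembly.LeafSystem C W.pin.toTowerRun) ∧
          ∀ gmin gmax : ℝ, 0 < gmin → gmin ≤ gmax → B10Assembly.O1 C gmin gmax ≤ O gmin gmax) :
    S_N08 Rec :=
  s_N08_of_refines₉CB10 Rec href fun L hO hL => by
    obtain ⟨𝔗, c, hc, O, hdata⟩ := h L hO hL
    exact printedUV3V_of_perRunUniformO1 N L 𝔗 c hc O hdata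

end UniformO1

end Summit.QuantumFields.YangMills.Theorems.BalabanUVNodesN08UniformO1

end
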